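import Summits.CriticalPhenomena.PercolationContinuityZ3.Theorems.PercNearOneGluingNoHeavyLowerTailSahiJoinAbsorption
import Literature.Combinatorics.Sahi2008.FKG
import HarnessLib

/-!
# `NoHeavyLowerTail` (stmt-CriticalPhenomena-4575) — join absorption on an FKG lattice: NEW PROVED CASES OF SAHI'S CONJECTURE 5
# at every order for EVERY FKG weight (two monotone core functions, or any Sahi-positive core, plus absorbers)

Support file, seat `prim-l12-p5` (gen 12), `--supports stmt-CriticalPhenomena-4575`.  Standard axioms, no definitions, no sorries.

Sahi's Conjecture 5 [Sahi2008, p. 212] / [LiebSahi2021, Conj. 1.1]: `E_n(f_1,…,f_n) ≥ 0` for positive monotone functions under a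
weight satisfying the FKG lattice condition.  By the join-absorption factorisation (`…SahiJoinAbsorption.sahiE_joinFam_eq`,
`E_{k+1+m}(h, g) = Φ_{k+1}(h)·E_{k+1}(g)` when `g_j·h_i = g_j`, `Φ ≥ 0` for `[0,1]`-valued `h`) the conjecture for a family
"core `g` + functions `h_i` equal to `1` on the core's supports" REDUCES to the core.  With the FKG inequality as the core input
(`Literature.…Sahi2008.sahiPositive_two`, `ex_mul_ex_le_ex_mul`):

* **`sahiE_joinFam_nonneg_two_core_of_isFKGMeasure`** / `sahiE_snoc_snoc_nonneg_of_isFKGMeasure` — for EVERY FKG weight on a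
  finite distributive lattice, two nonnegative monotone functions `g_0, g_1` together with ANY number of `[0,1]`-valued functions
  `h_i` with `g_j·h_i = g_j` have `E_{m+2} ≥ 0`.  The `h_i` need NOT be monotone and need not absorb each other: e.g. increasing
  events `G_0, G_1` and arbitrary events `H_i ⊇ G_0 ∪ G_1` (`sahiE_indicator_nonneg_two_core_of_isFKGMeasure`).
* `sahiE_joinFam_nonneg_of_sahiPositive_core` — the general reduction: `SahiPositive μ (k+1)` + monotone nonnegative core of
  `k+1` functions + absorbers ⇒ `E ≥ 0` (so every order-`k+1` case of the conjecture proved in the tree — chains off one point,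
  `2^X` with `|X| ≤ 2`, linear orders, … — propagates to all such enlarged families at every order).
Together with the bottom-element theorem of `…SahiJoinAbsorption` (one-function core, any probability weight) these are, to the
seat's knowledge, not in print: [LiebSahi2021, Lemma 3.2] is the totally nested case. [this work; cite: Sahi2008, Conj. 5;
LiebSahi2021, Conj. 1.1, Prop. 3.3; FortuinKasteleynGinibre1971, Thm. (Prop. 1)]
-/

namespace Summit.CriticalPhenomena.PercolationContinuityZ3.Theorems

namespace SahiJoinAbsorption

open Finset Literature.Combinatorics.Sahi2008

variable {α : Type*} [Fintype α]

/-- **General reduction on a preorder**: a Sahi-positive order `k+1` for the weight, a monotone nonnegative core of `k+1`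
functions and `[0,1]`-valued absorbers give `E_{k+1+m} ≥ 0` (restatement of `sahiE_joinFam_nonneg_of_sahiPositive` for
reference from this file). [this work] -/
theorem sahiE_joinFam_nonneg_of_sahiPositive_core [Preorder α] {μ : α → ℝ} (hμ₀ : ∀ x, 0 ≤ μ x) (hμ₁ : ∑ x, μ x = 1)
    {k m : ℕ} (hSP : SahiPositive μ (k + 1)) (h : Fin m → α → ℝ) (g : Fin (k + 1) → α → ℝ)
    (hgh : ∀ i j, g j * h i = g j) (h0 : ∀ i x, 0 ≤ h i x) (h1 : ∀ i x, h i x ≤ 1)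
    (hg0 : ∀ j x, 0 ≤ g j x) (hgm : ∀ j, Monotone (g j)) :
    0 ≤ sahiE μ (k + m + 1) (joinFam h g) :=
  sahiE_joinFam_nonneg_of_sahiPositive hμ₀ hμ₁ hSP h g hgh h0 h1 hg0 hgm

/-- **Two monotone core functions plus absorbers, every FKG weight, every order** (`joinFam` placement):
`E_{m+2}(h_0,…,h_{m−1}, g_0, g_1) ≥ 0`. [this work; cite: Sahi2008, Conj. 5; FortuinKasteleynGinibre1971, Thm. (Prop. 1)] -/
theorem sahiE_joinFam_nonneg_two_core_of_isFKGMeasure [DistribLattice α] {μ : α → ℝ} (hμ : IsFKGMeasure μ) {m : ℕ}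
    (h : Fin m → α → ℝ) (g : Fin 2 → α → ℝ) (hgh : ∀ i j, g j * h i = g j)
    (h0 : ∀ i x, 0 ≤ h i x) (h1 : ∀ i x, h i x ≤ 1) (hg0 : ∀ j x, 0 ≤ g j x) (hgm : ∀ j, Monotone (g j)) :
    0 ≤ sahiE μ (1 + m + 1) (joinFam h g) :=
  sahiE_joinFam_nonneg_of_sahiPositive hμ.nonneg hμ.sum_eq_one (sahiPositive_two hμ) h g hgh h0 h1 hg0 hgm

/-- **Two monotone core functions plus absorbers, every FKG weight, every order** (`Fin.snoc` placement):
`E_{m+2}(h_0,…,h_{m−1}, g_0, g_1) = Φ_2(h)·(E(g_0g_1) − E(g_0)E(g_1)) ≥ 0` by the FKG inequality.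
[this work; cite: Sahi2008, Conj. 5; FortuinKasteleynGinibre1971, Thm. (Prop. 1)] -/
theorem sahiE_snoc_snoc_nonneg_of_isFKGMeasure [DistribLattice α] {μ : α → ℝ} (hμ : IsFKGMeasure μ) {m : ℕ}
    (h : Fin m → α → ℝ) (g₀ g₁ : α → ℝ) (hg₀ : ∀ i, g₀ * h i = g₀) (hg₁ : ∀ i, g₁ * h i = g₁)
    (h0 : ∀ i x, 0 ≤ h i x) (h1 : ∀ i x, h i x ≤ 1)
    (hg₀0 : ∀ x, 0 ≤ g₀ x) (hg₁0 : ∀ x, 0 ≤ g₁ x) (hg₀m : Monotone g₀) (hg₁m : Monotone g₁) :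
    0 ≤ sahiE μ (m + 2) (Fin.snoc (Fin.snoc h g₀ : Fin (m + 1) → α → ℝ) g₁ : Fin (m + 2) → α → ℝ) := by
  rw [sahiE_snoc_snoc_nonneg_iff hμ.nonneg hμ.sum_eq_one h g₀ g₁ hg₀ hg₁ h0 h1, sub_nonneg]
  exact ex_mul_ex_le_ex_mul hμ hg₀0 hg₁0 hg₀m hg₁m

/-- **Events**: for every FKG weight on a finite distributive lattice, two INCREASING events `G_0, G_1` (upper sets) and ARBITRARY
events `H_0,…,H_{m−1}` each containing `G_0 ∪ G_1` have `E_{m+2}(1_{H_0},…,1_{H_{m−1}}, 1_{G_0}, 1_{G_1}) ≥ 0` — the `H_i` need not be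
increasing. [this work; cite: Sahi2008, Conj. 5] -/
theorem sahiE_indicator_nonneg_two_core_of_isFKGMeasure [DistribLattice α] {μ : α → ℝ} (hμ : IsFKGMeasure μ) {m : ℕ}
    (H : Fin m → Set α) (G₀ G₁ : Set α) (hG₀ : IsUpperSet G₀) (hG₁ : IsUpperSet G₁)
    (h₀ : ∀ i, G₀ ⊆ H i) (h₁ : ∀ i, G₁ ⊆ H i) :
    0 ≤ sahiE μ (m + 2)
      (Fin.snoc (Fin.snoc (fun i => (H i).indicator (1 : α → ℝ)) (G₀.indicator 1) : Fin (m + 1) → α → ℝ)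
        (G₁.indicator 1) : Fin (m + 2) → α → ℝ) := by
  classical
  have hsub : ∀ {A B : Set α}, B ⊆ A → B.indicator (1 : α → ℝ) * A.indicator 1 = B.indicator 1 := fun hBA => by
    rw [← Set.inter_indicator_one, Set.inter_eq_left.2 hBA]
  have hmono : ∀ (G : Set α), IsUpperSet G → Monotone (G.indicator (1 : α → ℝ)) := fun G hG x y hxy => by
    by_cases hx : x ∈ G
    · rw [Set.indicator_of_mem hx, Set.indicator_of_mem (hG hxy hx), Pi.one_apply, Pi.one_apply]
    · rw [Set.indicator_of_notMem hx]
      exact Set.indicator_nonneg (fun _ _ => zero_le_one) y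
  exact sahiE_snoc_snoc_nonneg_of_isFKGMeasure hμ _ _ _ (fun i => hsub (h₀ i)) (fun i => hsub (h₁ i))
    (fun i x => Set.indicator_nonneg (fun _ _ => zero_le_one) x)
    (fun i x => Set.indicator_le_self' (fun _ _ => zero_le_one) x)
    (fun x => Set.indicator_nonneg (fun _ _ => zero_le_one) x) (fun x => Set.indicator_nonneg (fun _ _ => zero_le_one) x)
    (hmono _ hG₀) (hmono _ hG₁)

end SahiJoinAbsorption

end Summit.CriticalPhenomena.PercolationContinuityZ3.Theorems
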